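import Summits.ResolutionOfSingularities.ResolutionOfSingularities.Theorems.StallVertexForms
import HarnessLib

/-!
# StallVertexClean — decomp-res node «StallVertex» (lens-5 g20 rev 2), tree file 5/9 of the node

Content VERBATIM from the decomp-res lens-5 g20 file
`HOME/decomp-res-lens-5/g20/parts/StallVertex-g20-rev2-d6168cb0.lean` (1724 l; rev 2, which SUPERSEDES
the pins 0349e14d (869 l) and rev 1 d60a69dd with all earlier statements byte-identical; HOME =
run/shared/lean/pub/decomp-res).  The rev-0 sections §1/§2/§3/§4
are ALREADY in the tree from pin 0349e14d as `StallVertexForms` / `StallVertexKernels` / `StallVertexWalk` /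
`StallVertexClasses`; this file carries ONLY
declarations NEW in rev 1 / rev 2.  Critic: CRITIC-LEDGER rows 142 (CLEARED 20:41:19Z: the stall vertex law), 142a
(21:01:24Z: rev 1 stall rigidity), 142b
(21:17:44Z: rev 2 contact-line law; ONE located-residual aside = `StallVertex.NoLineFreeRigidSkewStalledTailsDeep`,
the sharpest exact form, chain
skew ↔ vertexBound ↔ rigid ↔ lineFree hypothesis-free, superseding `CoefficientCut.NoSkewJointTailsDeep`).
Landed by decomp-res writer g7.  Every file of the
node is in the Theses cone (the lens imports the in-cone `DifferentialShade`), so the residual is booked on the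
route by RE-LOCATING the existing aside 28122
`CFNoSkewJointTailsDeep` (EXACTLY ⟺ it) — one aside, not two.

§1 additions of rev 1 / rev 2 (l. 296–500, `section Algebra`): the universal upper bound
`ordZero_dirForm_add_le`; §1c clean moves — `homogeneousComponent_X_pow_mul`,
`tailForm`, `move_eq_layer`, `CleanMove`, `ordZero_move_of_clean`, `initialForm_move_of_clean`,
`Finsupp.eq_of_le_of_degree_eq'`,
`translate_eq_homogeneousComponent_of_le_ordZero`.  PROVED, 0 sorry.  Imports the landed `StallVertexForms`.

[WRITER NOTE (decomp-res writer g7): file split only; namespace, opens, section variables and every declaration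
exactly as in the lens (global `set_option` dropped; the lens's `set_option maxHeartbeats … in` on `stall_rigid` kept).]

(Sources: KawanoueMatsuki2016 Prop. 4 (2), §4.1; Hauser2010; HauserPerlega2024; Moh1987; CossartPiltant2008;
Giraud1975; Hironaka1964; ZariskiSamuelII Ch. VIII §2.)
-/

noncomputable section

open MvPolynomial Finset
open Literature.AlgebraicGeometry.Resolution
open Literature.AlgebraicGeometry.Resolution.Hauser2010
open Literature.AlgebraicGeometry.Resolution.HauserPerlega2024
open Literature.Barriers.ResolutionOfSingularities
open Literature.AlgebraicGeometry.Resolution.PointBlowup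
open Summit.ResolutionOfSingularities.ResolutionOfSingularities.Theses
open Summit.ResolutionOfSingularities.ResolutionOfSingularities.Theorems.TightDefectClasses
open Summit.ResolutionOfSingularities.ResolutionOfSingularities.Theorems.ProximityCut
open Summit.ResolutionOfSingularities.ResolutionOfSingularities.Theorems.ExitLaw
open Summit.ResolutionOfSingularities.ResolutionOfSingularities.Theorems.DifferentialShade

namespace Summit.ResolutionOfSingularities.ResolutionOfSingularities.Theorems.StallVertex

section Algebra

variable {σ : Type*} {K : Type*} [Field K] [Fintype σ] [DecidableEq σ]

/-- **THE UNIVERSAL UPPER BOUND FOR THE VERTEX ORDER.**  If every monomial `u^e` of `G` dominates the exponent `s`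
(`s ≤ e`, `s` supported on translated coordinates `b_i ≠ 0`, `s_j = 0`) and has `u_j`-exponent at least `k`, then
`ord₀ (dirForm d j b G) + k + |s| ≤ d`: in the chart `u_j` the top form loses its `u_j`-content (at least `k`), and
the monomial `u^s` becomes the UNIT `∏ (u_i + b_i)^{s_i}` at the point `b`, which carries no order.  (A form has
multiplicity at most its degree at any point; this is the sharp version keeping track of the coordinate contents.)
[folklore: Zariski–Samuel Vol. II Ch. VIII §2; new in this form] [folklore] -/
theorem ordZero_dirForm_add_le {d : ℕ} (j : σ) (b : σ → K) {G : MvPolynomial σ K} (hd : ordZero G = d)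
    (s : σ →₀ ℕ) (hsj : s j = 0) (hsb : ∀ i, s i ≠ 0 → b i ≠ 0) (k : ℕ)
    (hG : ∀ e ∈ G.support, s ≤ e ∧ k ≤ e j) :
    ordZero (dirForm d j b G) + ((s.degree + k : ℕ) : ℕ∞) ≤ (d : ℕ∞) := by
  classical
  have hΦne : homogeneousComponent d G ≠ 0 := homogeneousComponent_ne_zero_of_ordZero_eq hd
  have hdeg : ∀ e ∈ (homogeneousComponent d G).support, e.degree = d :=
    fun e he => degree_eq_of_mem_support_homogeneousComponent he
  set Θ := chartTransform d j (homogeneousComponent d G) with hΘdef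
  have hΘne : Θ ≠ 0 := chartTransform_ne_zero d j hΦne (fun e he => (hdeg e he).ge)
  -- every monomial of `Θ` dominates `s` and has degree `≤ d - k`
  have hΘsupp : ∀ f ∈ Θ.support, s ≤ f ∧ f.degree + k ≤ d := by
    intro f hf
    obtain ⟨e, he, rfl⟩ := exists_of_mem_support_chartTransform hf
    have heG : e ∈ G.support := mem_support_of_mem_support_homogeneousComponent he
    obtain ⟨hse, hke⟩ := hG e heG
    refine ⟨fun i => ?_, ?_⟩
    · rw [chartExponent_apply]
      by_cases hij : i = j
      · rw [if_pos hij, hij, hsj]; exact Nat.zero_le _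
      · rw [if_neg hij]; exact hse i
    · rw [degree_chartExponent, hdeg e he, Nat.sub_self, zero_add]
      have h1 := degree_eq_add_sum_erase j e
      have h2 := hdeg e he
      omega
  -- `Θ = u^s · Θ₁`
  have hmod : MvPolynomial.modMonomial Θ s = 0 := by
    ext f
    rw [coeff_zero]
    by_cases h : s ≤ f
    · exact coeff_modMonomial_of_le _ h
    · rw [coeff_modMonomial_of_not_le _ h]
      by_contra hne
      exact h (hΘsupp f (MvPolynomial.mem_support_iff.mpr hne)).1
  set Θ₁ := MvPolynomial.divMonomial Θ s with hΘ₁def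
  have hfac : Θ = monomial s 1 * Θ₁ := by
    have h := divMonomial_add_modMonomial Θ s
    rw [hmod, add_zero] at h
    exact h.symm
  have hΘ₁ne : Θ₁ ≠ 0 := by
    intro h0; apply hΘne; rw [hfac, h0, mul_zero]
  -- the unit `∏ (u_i + b_i)^{s_i}` carries no order at `b`
  have hunit : ordZero (PointBlowup.translate b (monomial s (1 : K))) = 0 := by
    refine (ordZero_eq_zero_iff _).mpr ?_
    rw [constantCoeff_translate, eval_monomial, one_mul, Finsupp.prod]
    exact Finset.prod_ne_zero_iff.mpr fun i hi => pow_ne_zero _ (hsb i (Finsupp.mem_support_iff.mp hi))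
  have h1 : ordZero (dirForm d j b G) = ordZero (PointBlowup.translate b Θ₁) := by
    show ordZero (PointBlowup.translate b Θ) = _
    rw [hfac]
    unfold PointBlowup.translate
    rw [map_mul, ordZero_mul]
    change ordZero (PointBlowup.translate b (monomial s 1)) + ordZero (PointBlowup.translate b Θ₁) = _
    rw [hunit, zero_add]
    rfl
  -- a monomial of `translate b Θ₁` is dominated by a monomial of `Θ₁`
  have hTne : PointBlowup.translate b Θ₁ ≠ 0 := translate_ne_zero b hΘ₁ne
  obtain ⟨β, hβ⟩ := MvPolynomial.ne_zero_iff.mp hTne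
  obtain ⟨f, hf, hβf⟩ := exists_le_of_mem_support_translate b Θ₁ (MvPolynomial.mem_support_iff.mpr hβ)
  have hfΘ : s + f ∈ Θ.support := by
    rw [MvPolynomial.mem_support_iff] at hf ⊢
    rwa [hΘ₁def, coeff_divMonomial] at hf
  have hdeg' : (s + f).degree + k ≤ d := (hΘsupp _ hfΘ).2
  obtain ⟨c, rfl⟩ := exists_add_of_le hβf
  rw [map_add, map_add] at hdeg'
  rw [h1]
  calc ordZero (PointBlowup.translate b Θ₁) + ((s.degree + k : ℕ) : ℕ∞)
      ≤ (β.degree : ℕ∞) + ((s.degree + k : ℕ) : ℕ∞) :=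
        add_le_add (ordZero_le_of_coeff_ne_zero _ β hβ) le_rfl
    _ ≤ (d : ℕ∞) := by
        rw [← Nat.cast_add, Nat.cast_le]
        omega

/-! ### §1c Transport of the initial form through a CLEAN move; the equality case of the universal bound -/

omit [Fintype σ] [DecidableEq σ] in
/-- `homogeneousComponent (m + n) (u_j^m · P) = u_j^m · homogeneousComponent n P`. [folklore] -/
theorem homogeneousComponent_X_pow_mul (j : σ) (m n : ℕ) (P : MvPolynomial σ K) :
    homogeneousComponent (m + n) (X j ^ m * P) = X j ^ m * homogeneousComponent n P := by
  classical
  ext e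
  simp only [coeff_homogeneousComponent, X_pow_eq_monomial, coeff_monomial_mul', one_mul]
  by_cases hle : Finsupp.single j m ≤ e
  · have hdeg : e.degree = (e - Finsupp.single j m).degree + m := by
      conv_lhs => rw [← tsub_add_cancel_of_le hle]
      rw [map_add, Finsupp.degree_single]
    simp only [if_pos hle]
    split_ifs <;> first | rfl | (exfalso; omega)
  · simp only [if_neg hle]
    split_ifs <;> rfl

/-- **The tail of a move.** Everything of `G` strictly above its initial form `in_d(G)`, read in the chart `u_j` with
exponent `d + 1` and translated to the new point: `translate b (chartTransform a j G) = u_j^{d-a} · (dirForm + u_j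
· tailForm)`
(`move_eq_layer`).  [folklore: Hauser2010 §F] -/
noncomputable def tailForm (d : ℕ) (j : σ) (b : σ → K) (G : MvPolynomial σ K) : MvPolynomial σ K :=
  PointBlowup.translate b (chartTransform (d + 1) j (G - homogeneousComponent d G))

omit [Fintype σ] in
/-- **The layer decomposition of one move**: `translate b (chartTransform a j G) = u_j^{d-a} · (dirForm d j b G +
u_j · tailForm d j b G)`
for `b_j = 0`, `a ≤ d = ord₀ G`. [folklore: Hauser2010 §F] [folklore] -/
theorem move_eq_layer (b : σ → K) {j : σ} (hbj : b j = 0) {a d : ℕ} (had : a ≤ d)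
    {G : MvPolynomial σ K} (hd : ordZero G = d) :
    PointBlowup.translate b (chartTransform a j G) = X j ^ (d - a) * (dirForm d j b G + X j * tailForm d j b G) := by
  set Φ := homogeneousComponent d G with hΦ
  set R := G - Φ with hR
  have hdle : (d : ℕ∞) ≤ ordZero G := by rw [hd]
  have hRord : ((d + 1 : ℕ) : ℕ∞) ≤ ordZero R := succ_le_ordZero_sub_homogeneousComponent hdle
  have hG : G = Φ + R := by rw [hR]; ring
  have h1 : chartTransform a j G = X j ^ (d - a) * chartTransform d j G :=
    chartTransform_eq_X_pow_mul_chartTransform j had hdle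
  have h2 : chartTransform d j G = chartTransform d j Φ + chartTransform d j R := by
    conv_lhs => rw [hG]
    exact chartTransform_add d j Φ R
  have h3 : chartTransform d j R = X j ^ (d + 1 - d) * chartTransform (d + 1) j R :=
    chartTransform_eq_X_pow_mul_chartTransform j (Nat.le_succ d) hRord
  rw [Nat.add_sub_cancel_left] at h3
  rw [h1, translate_X_pow_mul' b hbj, h2, HauserPerlega2024.translate_add, h3, translate_X_pow_mul' b hbj, pow_one]
  rfl

/-- **A CLEAN move** (for the generator `G` of order `d`): the tail does not reach the order of the direction form —
`ord₀ dirForm < 1 + ord₀ tailForm` — i.e. NO higher homogeneous piece of `G` INTERFERES with the transported tangent cone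
(`initialForm_move_of_clean`).  The negation is the INTERFERENCE event of the g20 census (85 / 1260 stalled pairs). [new] -/
def CleanMove (d : ℕ) (j : σ) (b : σ → K) (G : MvPolynomial σ K) : Prop :=
  ordZero (dirForm d j b G) < 1 + ordZero (tailForm d j b G)

omit [Fintype σ] in
/-- Under a clean move the order of the transform is EXACTLY `(d - a) + ord₀ dirForm` (Lemma A attained for a visible
reason; at a `μ̃`-stall it is attained anyway, `stall_rigid` (2)). [new] [folklore] -/
theorem ordZero_move_of_clean (b : σ → K) {j : σ} (hbj : b j = 0) {a d : ℕ} (had : a ≤ d)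
    {G : MvPolynomial σ K} (hd : ordZero G = d) {n : ℕ} (hn : ordZero (dirForm d j b G) = n)
    (hc : CleanMove d j b G) :
    ordZero (PointBlowup.translate b (chartTransform a j G)) = ((d - a + n : ℕ) : ℕ∞) := by
  have hlt : ordZero (dirForm d j b G) < ordZero (X j * tailForm d j b G) := by
    rw [ordZero_mul, ordZero_X]; exact hc
  rw [move_eq_layer b hbj had hd, ordZero_mul, ordZero_X_pow, ordZero_add_eq_left_of_lt hlt, hn, Nat.cast_add]

omit [Fintype σ] in
/-- **FORM-LEVEL TRANSPORT THROUGH A CLEAN MOVE.**  If the move `(j, b)` is clean for `G` (order `d`, carried at level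
`a`), the initial form of the transform is the initial form of the direction form shifted by `u_j^{d-a}`:
`in_{(d-a)+n}(G') = u_j^{d-a} · in_n(dirForm d j b G)` — THE TANGENT CONE AT THE NEW POINT IS THE (re-centred,
dehomogenised) TANGENT CONE AT THE OLD POINT, verbatim.  [new] [folklore] -/
theorem initialForm_move_of_clean (b : σ → K) {j : σ} (hbj : b j = 0) {a d : ℕ} (had : a ≤ d)
    {G : MvPolynomial σ K} (hd : ordZero G = d) {n : ℕ} (hn : ordZero (dirForm d j b G) = n)
    (hc : CleanMove d j b G) :
    homogeneousComponent (d - a + n) (PointBlowup.translate b (chartTransform a j G)) =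
      X j ^ (d - a) * homogeneousComponent n (dirForm d j b G) := by
  have hlt : (n : ℕ∞) < ordZero (X j * tailForm d j b G) := by
    rw [ordZero_mul, ordZero_X, ← hn]; exact hc
  rw [move_eq_layer b hbj had hd, homogeneousComponent_X_pow_mul, map_add,
    homogeneousComponent_eq_zero_of_lt_ordZero hlt, add_zero]

omit [Fintype σ] [DecidableEq σ] in
/-- Two comparable exponents of the same degree are equal. [folklore] -/
theorem Finsupp.eq_of_le_of_degree_eq' {β e : σ →₀ ℕ} (hle : β ≤ e) (hdeg : e.degree ≤ β.degree) : β = e := by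
  have h := tsub_add_cancel_of_le hle
  have hd : (e - β).degree = 0 := by
    have := congrArg Finsupp.degree h
    rw [map_add] at this
    omega
  rw [Finsupp.degree_eq_zero_iff] at hd
  rw [hd, zero_add] at h
  exact h

/-- **THE EQUALITY CASE OF THE UNIVERSAL BOUND: A TRANSLATED FORM.**  If every monomial of `Q` has degree `≤ D` and the
translate `Q(u + b)` has order `≥ D` at the origin, then `Q(u + b) = in_D(Q)`: the polynomial `Q` IS THE FORM `in_D(Q)`
RE-CENTRED AT `-b` (`Q(u) = in_D(Q)(u - b)`).  In one variable: a polynomial of degree `≤ D` with a `D`-fold root at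
`-b` is `c · (u + b)^D`.  This is what attaining `ordZero_dirForm_add_le` costs (`stall_rigid` (1) says it IS attained
at every `μ̃`-stall): the stripped tangent cone is a PURE TRANSLATED FORM.  [folklore; new use] [folklore] -/
theorem translate_eq_homogeneousComponent_of_le_ordZero (b : σ → K) {Q : MvPolynomial σ K} {D : ℕ}
    (hdeg : ∀ e ∈ Q.support, e.degree ≤ D) (hord : (D : ℕ∞) ≤ ordZero (PointBlowup.translate b Q)) :
    PointBlowup.translate b Q = homogeneousComponent D Q := by
  classical
  set T := PointBlowup.translate b Q with hT
  -- every monomial of `T` has degree exactly `D`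
  have hTdeg : ∀ β ∈ T.support, β.degree = D := by
    intro β hβ
    obtain ⟨e, he, hle⟩ := exists_le_of_mem_support_translate b Q hβ
    have h1 : β.degree ≤ D := (degree_le_degree_of_le hle).trans (hdeg e he)
    have h2 : D ≤ β.degree := by
      by_contra hlt
      push Not at hlt
      exact (MvPolynomial.mem_support_iff.mp hβ)
        (coeff_eq_zero_of_degree_lt_ordZero (lt_of_lt_of_le (by exact_mod_cast hlt) hord))
    exact le_antisymm h1 h2
  ext β
  rw [coeff_homogeneousComponent]
  by_cases hβD : β.degree = D
  · rw [if_pos hβD, hT, translate_eq_sum_support, coeff_sum,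
      Finset.sum_eq_single β (fun e he hne => ?_) (fun h => ?_)]
    · exact WeightedBlowup.coeff_translate_monomial_self b β (coeff β Q)
    · by_contra h
      have hle : β ≤ e := le_of_coeff_translate_monomial_ne_zero b h
      exact hne (Finsupp.eq_of_le_of_degree_eq' hle (by rw [hβD]; exact hdeg e he)).symm
    · rw [MvPolynomial.notMem_support_iff.mp h, monomial_zero]
      unfold PointBlowup.translate
      rw [map_zero, coeff_zero]
  · rw [if_neg hβD]
    by_contra hne
    exact hβD (hTdeg β (MvPolynomial.mem_support_iff.mpr hne))

end Algebra

end Summit.ResolutionOfSingularities.ResolutionOfSingularities.Theorems.StallVertex
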